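import Literature.AlgebraicGeometry.Resolution.HenselizedFunctionFieldsImmediate
import Literature.AlgebraicGeometry.Resolution.ResidueTranscendentalExtensions
import Literature.AlgebraicGeometry.Resolution.NormalDegreePDefectlessInseparable
import HarnessLib

/-!
# No proper immediate algebraic extensions (Kuhlmann 2010, §5, p. 19): Prop. 2.18 is not needed

Topic: `Literature/AlgebraicGeometry/Resolution` (valued function fields). Companion of
`HenselizedFunctionFieldsImmediate.lean`, which proves the displayed statement of p. 19 of
F.-V. Kuhlmann, *Elimination of ramification I: The generalized stability theorem*, Trans. AMS
362 (2010) = arXiv:1003.5678 (residue-transcendental case, named fact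
`Kuhlmann2010NoImmediateExtensionRT`) from THREE named facts: the reduction to a tower of normal
extensions of degree `p` over a finite unramified `N|F` (`Kuhlmann2010TameTowerReduction`),
Prop. 2.18 (`Kuhlmann2010DefectUnramifiedBaseChange`: `d(E|F,v) = d(E.N|N,v)`) and Cor. 4.2 /
Prop. 3.1 for the first step of the tower (`Kuhlmann2010NormalDegreePDefectless`). The printed
argument is

> By Proposition 2.18 we have `d(E|F,v) = d(E.N|N,v)`, hence it suffices to prove that `E.N|N`
> is defectless. Since this is trivial if `E.N = N`, we assume that `E.N ≠ N`. Then the first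
> extension in the tower is defectless by Corollary 4.2 or Proposition 3.1. This yields
> `d(E|F,v) = d(E.N|N,v) < [E.N:N] ≤ [E:F]`, that is, `(E|F,v)` cannot be immediate.

This file shows that for the displayed statement (i.e. for IMMEDIATE `E|F`) Prop. 2.18 can be
replaced by an elementary count, so that `Kuhlmann2010NoImmediateExtensionRT` follows from the two
named facts `Kuhlmann2010TameTowerReduction` and `Kuhlmann2010NormalDegreePDefectless` alone
(`Kuhlmann2010NoImmediateExtensionRT.of_parts₂`): if `E|F` is finite and immediate and `N|F` is
finite unramified, then `E.N|N` is again immediate — `v(E.N) = vK = vN` because `vK` is divisible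
and `E.N|F` is algebraic (Lemma 2.1), and
`[Nv:Fv]·[(E.N)v:Nv] = [(E.N)v:Fv] = [(E.N)v:Ev]·[Ev:Fv] ≤ [E.N:E]·1 ≤ [N:F] = [Nv:Fv]`
forces `[(E.N)v:Nv] = 1` —, whereas the first step `N₁|N` of the tower, being defectless of
degree `p`, has `(vN₁:vN)[N₁v:Nv] = p`, so that `(v(E.N):vN)[(E.N)v:Nv] ≥ p ≥ 2`; hence the
tower is empty, `E ≤ N`, and the unramified `N|F` squeezes `E = F` as in the parent file.

## Content (everything PROVED)

* `eq_of_isHenselizedInertiallyGeneratedRT_of_immediate_finite'` — the finite case of the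
  displayed statement from `Kuhlmann2010TameTowerReduction` and
  `Kuhlmann2010NormalDegreePDefectless` only.
* `Kuhlmann2010NoImmediateExtensionRT.of_parts₂` — the named fact from these two named facts
  (an algebraic immediate extension is exhausted by its finite immediate subextensions `F(a)`,
  exactly as in `Kuhlmann2010NoImmediateExtensionRT.of_parts`).
* `Kuhlmann2010NoImmediateExtensionRT.of_tameTower_of_galois` — with the purely inseparable
  steps discharged (`Kuhlmann2010PurelyInseparableDegreePDefectless_holds`,
  `NormalDegreePDefectlessInseparable.lean`), the displayed statement rests on the reduction of
  pp. 18–19 (`Kuhlmann2010TameTowerReduction`) and Cor. 4.2 (`Kuhlmann2010GaloisDegreePDefectless`)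
  alone.

## Sources

* F.-V. Kuhlmann, Trans. AMS 362 (2010) = arXiv:1003.5678: §2.1 (Lemma 2.1, immediate
  extensions), §5, proof of (R4), pp. 18–19 (the displayed statement and the five lines before
  it). The replacement of Prop. 2.18 by the count above is [folklore] (multiplicativity of
  residue degrees and the fundamental inequality, `relIndex_mul_relfinrank_le_relfinrank`).
-/

noncomputable section

open IsLocalRing

namespace Literature.AlgebraicGeometry.Resolution

universe u

variable {Ω : Type u} [Field Ω] {V : ValuationSubring Ω}

/-- **The finite case of the displayed statement of p. 19 without Prop. 2.18**: for `F` in the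
class `IsHenselizedInertiallyGeneratedRT V K` (`K` algebraically closed), `F ≤ E` finite with
`Ev = Fv`, one has `E = F` (the hypothesis `vE = vF` of "immediate" is automatic: `vE = vK = vF`
by Lemma 2.1, and is not used). PROVED from `Kuhlmann2010TameTowerReduction` (with
Lemma 2.27) and `Kuhlmann2010NormalDegreePDefectless`: with `N` and the tower from the reduction,
either `E.N = N` — then `F ≤ E ≤ N` with `N|F` unramified and `Ev = Fv` gives `[E:F] = 1` — or
the tower has a first step `N ≤ N₁ ≤ E.N`, defectless of degree `p`, whence
`(v(E.N):vN)[(E.N)v:Nv] ≥ p`; but `v(E.N) = vK = vN` (Lemma 2.1: `vK` divisible, `E.N|F`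
algebraic) and `[Nv:Fv]·[(E.N)v:Nv] = [(E.N)v:Ev]·[Ev:Fv] ≤ [E.N:E] ≤ [N:F] = [Nv:Fv]` gives
`[(E.N)v:Nv] = 1`, a contradiction. [cite: Kuhlmann2010, Section 5, proof of (R4) (p. 19)] -/
theorem eq_of_isHenselizedInertiallyGeneratedRT_of_immediate_finite' [IsAlgClosed Ω] {p : ℕ}
    [CharP (ResidueField V) p] (hp : p.Prime) (hα : Kuhlmann2010TameTowerReduction.{u})
    (hδ : Kuhlmann2010NormalDegreePDefectless.{u})
    {K F E : Subfield Ω} (hK : IsAlgClosed K) (hF : IsHenselizedInertiallyGeneratedRT V K F)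
    (hle : F ≤ E) (hpos : 0 < Subfield.relfinrank F E)
    (hr : residueSubfield E V = residueSubfield F V) : E = F := by
  obtain ⟨N, hN, htower⟩ := hα Ω V p hp K F E hK hF hle hpos
  -- Lemma 2.27: `N` is in the class
  have hNC : IsHenselizedInertiallyGeneratedRT V K N := hF.of_isUnramifiedOver hN
  obtain ⟨hFN, hNpos, hNdeg, -, -⟩ := id hN
  -- the tower, with its top generalized
  obtain ⟨T, hT, htower'⟩ : ∃ T : Subfield Ω, E ⊔ N = T ∧ IsNormalPTower p N T := ⟨_, rfl, htower⟩
  rcases htower' with _ | @⟨_, N₁, _, h₁, h₂⟩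
  · -- `E.N = N`: `F ≤ E ≤ N` with `N|F` unramified and `Ev = Fv` forces `[E : F] = 1`
    have hEN : E ≤ N := sup_eq_right.mp hT
    have hmul := Subfield.relfinrank_mul_relfinrank hle hEN
    have hn₂ : 0 < Subfield.relfinrank E N := by
      rcases Nat.eq_zero_or_pos (Subfield.relfinrank E N) with h0 | h0
      · rw [h0, mul_zero] at hmul
        omega
      · exact h0
    obtain ⟨he, -, hfi⟩ := relIndex_mul_relfinrank_le_relfinrank V hEN hn₂
    have hres : (residueSubfield F V).relfinrank (residueSubfield N V) =
        (residueSubfield E V).relfinrank (residueSubfield N V) := by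
      rw [← Subfield.relfinrank_mul_relfinrank (residueSubfield_subfield_mono (V := V) hle)
        (residueSubfield_subfield_mono hEN), hr, Subfield.relfinrank_self, one_mul]
    have hle' : Subfield.relfinrank F N ≤ Subfield.relfinrank E N := by
      rw [hNdeg, hres]
      exact (Nat.le_mul_of_pos_left _ he).trans hfi
    have h1 : Subfield.relfinrank F E = 1 := by
      have h3 : Subfield.relfinrank F E * Subfield.relfinrank E N ≤ 1 * Subfield.relfinrank E N := by
        rw [hmul, one_mul]
        exact hle'
      have h4 := Nat.le_of_mul_le_mul_right h3 hn₂
      omega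
    exact le_antisymm (Subfield.relfinrank_eq_one_iff.mp h1) hle
  · -- a first step `N ≤ N₁`, normal of degree `p`, defectless (Cor. 4.2 / Prop. 3.1)
    obtain ⟨hNN₁, -, heq₁⟩ := hδ Ω V p hp K N N₁ hK hNC h₁
    have hp₁ : (valueSubgroup N V).relIndex (valueSubgroup N₁ V) *
        (residueSubfield N V).relfinrank (residueSubfield N₁ V) = p := by
      rw [← heq₁, h₁.relfinrank_eq]
    have hN₁T : N₁ ≤ T := h₂.le
    have hNT : N ≤ T := hNN₁.trans hN₁T
    obtain ⟨he₂, hf₂, -⟩ := relIndex_mul_relfinrank_le_relfinrank V hN₁T (h₂.relfinrank_pos hp.pos)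
    -- `(vT : vN)[Tv : Nv] ≥ p`
    have hef : p ≤ (valueSubgroup N V).relIndex (valueSubgroup T V) *
        (residueSubfield N V).relfinrank (residueSubfield T V) := by
      rw [← Subgroup.relIndex_mul_relIndex _ _ _ (valueSubgroup_subfield_mono hNN₁)
          (valueSubgroup_subfield_mono hN₁T),
        ← Subfield.relfinrank_mul_relfinrank (residueSubfield_subfield_mono (V := V) hNN₁)
          (residueSubfield_subfield_mono hN₁T)]
      calc p = (valueSubgroup N V).relIndex (valueSubgroup N₁ V) *
            (residueSubfield N V).relfinrank (residueSubfield N₁ V) * 1 := by rw [hp₁, mul_one]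
        _ ≤ (valueSubgroup N V).relIndex (valueSubgroup N₁ V) *
            (residueSubfield N V).relfinrank (residueSubfield N₁ V) *
            ((valueSubgroup N₁ V).relIndex (valueSubgroup T V) *
              (residueSubfield N₁ V).relfinrank (residueSubfield T V)) :=
          Nat.mul_le_mul_left _ (Nat.mul_pos he₂ hf₂)
        _ = _ := by ring
    -- the tower `N ≤ T` is finite, so `T|F` is finite, hence algebraic
    have hTpos : 0 < Subfield.relfinrank N T := (IsNormalPTower.step h₁ h₂).relfinrank_pos hp.pos
    have hET : E ≤ T := hT ▸ (le_sup_left : E ≤ E ⊔ N)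
    have hFT : F ≤ T := hle.trans hET
    have hFTpos : 0 < Subfield.relfinrank F T := by
      rw [← Subfield.relfinrank_mul_relfinrank hFN hNT]
      exact Nat.mul_pos hNpos hTpos
    have halgT : ∀ a ∈ T, IsAlgebraic F a := fun a ha =>
      isAlgebraic_of_relfinrank_pos hFT hFTpos ha
    -- `vT = vK = vN` (Lemma 2.1), so `(vT : vN) = 1`
    have hvT : valueSubgroup T V = valueSubgroup K V := hF.valueSubgroup_eq_of_algebraic hK hFT halgT
    have hvN : valueSubgroup N V = valueSubgroup K V := hNC.valueSubgroup_eq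
    have he1 : (valueSubgroup N V).relIndex (valueSubgroup T V) = 1 := by
      rw [hvT, ← hvN, Subgroup.relIndex_self]
    -- `[Tv : Nv] = 1`: `[Nv:Fv]·[Tv:Nv] = [Tv:Ev]·[Ev:Fv] ≤ [T:E] ≤ [N:F] = [Nv:Fv]`
    have hETpos : 0 < Subfield.relfinrank E T := by
      have hmul := Subfield.relfinrank_mul_relfinrank hle hET
      rw [← hmul] at hFTpos
      exact Nat.pos_of_mul_pos_left hFTpos
    obtain ⟨heET, -, hfiET⟩ := relIndex_mul_relfinrank_le_relfinrank V hET hETpos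
    have hfET : (residueSubfield E V).relfinrank (residueSubfield T V) ≤ Subfield.relfinrank E T :=
      (Nat.le_mul_of_pos_left _ heET).trans hfiET
    have hbase : Subfield.relfinrank E T ≤ Subfield.relfinrank F N := by
      rw [← hT]
      exact relfinrank_sup_le_relfinrank hle hFN hNpos.ne'
    have hfFT₁ : (residueSubfield F V).relfinrank (residueSubfield T V) =
        (residueSubfield E V).relfinrank (residueSubfield T V) := by
      rw [← Subfield.relfinrank_mul_relfinrank (residueSubfield_subfield_mono (V := V) hle)
        (residueSubfield_subfield_mono hET), hr, Subfield.relfinrank_self, one_mul]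
    have hfFT₂ : (residueSubfield F V).relfinrank (residueSubfield T V) =
        Subfield.relfinrank F N * (residueSubfield N V).relfinrank (residueSubfield T V) := by
      rw [← Subfield.relfinrank_mul_relfinrank (residueSubfield_subfield_mono (V := V) hFN)
        (residueSubfield_subfield_mono hNT), hNdeg]
    have hf1 : (residueSubfield N V).relfinrank (residueSubfield T V) = 1 := by
      obtain ⟨-, hfNT, -⟩ := relIndex_mul_relfinrank_le_relfinrank V hNT hTpos
      have h3 : Subfield.relfinrank F N * (residueSubfield N V).relfinrank (residueSubfield T V) ≤
          Subfield.relfinrank F N * 1 := by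
        rw [← hfFT₂, hfFT₁, mul_one]
        exact hfET.trans hbase
      have h4 := Nat.le_of_mul_le_mul_left h3 hNpos
      omega
    -- contradiction: `p ≤ 1`
    exfalso
    rw [he1, hf1, mul_one] at hef
    exact absurd hef (not_le.mpr hp.one_lt)

/-- **Kuhlmann 2010, §5, p. 19 (displayed statement), residue-transcendental case, PROVED from
the reduction of pp. 18–19 (with Lemma 2.27) and Cor. 4.2 / Prop. 3.1 alone**
(`Kuhlmann2010TameTowerReduction`, `Kuhlmann2010NormalDegreePDefectless`; Prop. 2.18 is not
needed for immediate extensions, see the module docstring). An immediate algebraic extension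
`E ≥ F` inside `Ω` is the union of its finite subextensions `F(a)`, which are immediate, hence
trivial by the finite case (`eq_of_isHenselizedInertiallyGeneratedRT_of_immediate_finite'`).
[cite: Kuhlmann2010, Section 5, proof of (R4) (pp. 18–19)] -/
theorem Kuhlmann2010NoImmediateExtensionRT.of_parts₂ (hα : Kuhlmann2010TameTowerReduction.{u})
    (hδ : Kuhlmann2010NormalDegreePDefectless.{u}) : Kuhlmann2010NoImmediateExtensionRT.{u} := by
  intro Ω _ _ V p _ hp K F E hK hF hle halg himm
  refine le_antisymm (fun a ha => ?_) hle
  -- the finite immediate subextension `E₀ = F(a)`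
  let E₀' : IntermediateField F Ω := IntermediateField.adjoin F ({a} : Set Ω)
  have hFE₀ : F ≤ E₀'.toSubfield := subfield_le_toSubfield E₀'
  have haE₀ : a ∈ E₀'.toSubfield := IntermediateField.subset_adjoin F ({a} : Set Ω) rfl
  have hE₀E : E₀'.toSubfield ≤ E := by
    have h1 : E₀' ≤ Subfield.extendScalars hle :=
      IntermediateField.adjoin_le_iff.mpr (Set.singleton_subset_iff.mpr ha)
    exact fun y hy => h1 hy
  haveI : FiniteDimensional F E₀' :=
    IntermediateField.adjoin.finiteDimensional (halg a ha).isIntegral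
  have hpos : 0 < Subfield.relfinrank F E₀'.toSubfield := by
    rw [relfinrank_toSubfield_eq_finrank]
    exact Module.finrank_pos
  obtain ⟨-, hrE⟩ := himm.valueSubgroup_eq_and_residueSubfield_eq V hle
  have hr₀ : residueSubfield E₀'.toSubfield V = residueSubfield F V :=
    le_antisymm (hrE ▸ residueSubfield_subfield_mono hE₀E) (residueSubfield_subfield_mono hFE₀)
  have hE₀F := eq_of_isHenselizedInertiallyGeneratedRT_of_immediate_finite' hp hα hδ hK hF hFE₀
    hpos hr₀
  rw [← hE₀F]
  exact haE₀

/-- **The displayed statement of p. 19 (residue-transcendental case) from the reduction of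
pp. 18–19 and Cor. 4.2 alone**: the purely inseparable steps of degree `p` being discharged
(`Kuhlmann2010PurelyInseparableDegreePDefectless_holds`, whence
`Kuhlmann2010NormalDegreePDefectless.of_galois`) and Prop. 2.18 being unnecessary (`of_parts₂`),
`Kuhlmann2010NoImmediateExtensionRT` follows from `Kuhlmann2010TameTowerReduction` (p. 18 l. −9 –
p. 19 l. 3 with Lemma 2.27) and `Kuhlmann2010GaloisDegreePDefectless` (Cor. 4.2: "every Galois
extension `(E|F,v)` of degree `p` is defectless"). PROVED.
[cite: Kuhlmann2010, Section 5, proof of (R4) (pp. 18–19), with Cor. 4.2] -/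
theorem Kuhlmann2010NoImmediateExtensionRT.of_tameTower_of_galois
    (hα : Kuhlmann2010TameTowerReduction.{u}) (hG : Kuhlmann2010GaloisDegreePDefectless.{u}) :
    Kuhlmann2010NoImmediateExtensionRT.{u} :=
  Kuhlmann2010NoImmediateExtensionRT.of_parts₂ hα (Kuhlmann2010NormalDegreePDefectless.of_galois hG)

end Literature.AlgebraicGeometry.Resolution
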